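import Mathlib.Topology.Homotopy.Product
import Mathlib.Analysis.Normed.Module.Ball.Homeomorph
import Literature.Topology.FourManifolds.PlumbingChart
import Literature.Topology.FourManifolds.SphereSimplyConnected
import Literature.AlgebraicTopology.FundamentalGroupoid.SimplyConnectedComplDiscrete
import Literature.AlgebraicTopology.FundamentalGroup.FiniteCover
import HarnessLib

/-!
# A sphere minus finitely many disjoint round caps is simply connected

Topic `Literature/Topology/FourManifolds`; elementary input for `π₁(∂M(4m)) = 1` in the
construction of Kosinski's plumbing `M(4m)` (A. Kosinski, *Differential Manifolds* (1993), VI.12,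
(12.1)): the part of `∂M(4m)` over a base sphere away from the crossing points is a trivial
`S^{k-1}`-bundle over the base sphere minus small caps around the crossing points, so we need

* `SphereCaps.isSimplyConnected_forall_inner_lt` — **`Sⁿ` minus finitely many pairwise separated
  closed round caps `{⟪q, uᵢ⟫ ≥ h}` is simply connected for `n ≥ 3`.** Proof: remove the caps one at
  a time; removing the cap `{⟪q, u⟫ ≥ h}` from an open set `W ⊇ {⟪q, u⟫ > h'}` gives a space
  homeomorphic to `W ∖ {u}` (push the annulus `h' < ⟪q, u⟫ < h` along the meridians onto the
  punctured cap `h' < ⟪q, u⟫ < 1`, `SphereCaps.capHomeomorph`), and `W ∖ {u}` is simply connected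
  by general position in dimension `≥ 3`
  (`Literature.AlgebraicTopology.FundamentalGroupoid.isSimplyConnected_compl_singleton_of_isOpenEmbedding`,
  with the stereographic chart at `u` as Euclidean neighbourhood).
* `SphereCaps.greatSphere h = {u | ‖u‖ = 1, ⟪u, h⟫ = 0}`, homeomorphic to the unit sphere of `(ℝ ∙ h)ᗮ`
  (`greatSphereHomeomorph`), hence simply connected for `n ≥ 3` and path connected for `n ≥ 2`.
* generic topology: `SphereCaps.simplyConnectedSpace_prod`, and the van Kampen step
  `SphereCaps.isSimplyConnected_union_inter` for relatively open pieces `O ∩ L`, `O' ∩ L` of a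
  subspace `L` (Hatcher, *Algebraic Topology* (2002), Lemma 1.15, via the tree's
  `simplyConnectedSpace_of_isOpen_union`).

Everything is proved; no named facts (D-0026).

## References

* A. Kosinski, *Differential Manifolds*, Academic Press 1993, VI.12, (12.1). [Kosinski1993]
* A. Hatcher, *Algebraic Topology*, CUP 2002, Prop. 1.14, Lemma 1.15. [HatcherAT2002]
-/

open scoped RealInnerProductSpace
open Set Function Module Metric Topology

noncomputable section

namespace Literature.Topology.FourManifolds

namespace SphereCaps

/-! ### §1 Generic topology -/

section Generic

/-- **A product of simply connected spaces is simply connected** (a path class in `α × β` is the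
product of its projections, Mathlib `Path.Homotopic.prod_projLeft_projRight`). [folklore] -/
theorem simplyConnectedSpace_prod {α β : Type*} [TopologicalSpace α] [TopologicalSpace β]
    [SimplyConnectedSpace α] [SimplyConnectedSpace β] : SimplyConnectedSpace (α × β) := by
  rw [simply_connected_iff_paths_homotopic]
  refine ⟨inferInstance, ?_⟩
  rintro ⟨a₁, b₁⟩ ⟨a₂, b₂⟩
  refine ⟨fun p q => ?_⟩
  rw [← Path.Homotopic.prod_projLeft_projRight p, ← Path.Homotopic.prod_projLeft_projRight q,
    Subsingleton.elim (Path.Homotopic.projLeft p) (Path.Homotopic.projLeft q),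
    Subsingleton.elim (Path.Homotopic.projRight p) (Path.Homotopic.projRight q)]

/-- Simple connectivity of subsets is invariant under homeomorphism of the subspaces. [folklore] -/
theorem isSimplyConnected_iff_of_homeomorph {X Y : Type*} [TopologicalSpace X] [TopologicalSpace Y]
    {S : Set X} {T : Set Y} (e : S ≃ₜ T) : IsSimplyConnected S ↔ IsSimplyConnected T :=
  e.toHomotopyEquiv.simplyConnectedSpace_iff

/-- **The van Kampen step for relatively open pieces** (Hatcher 2002, Lemma 1.15, trivial groups):
if `O`, `O'` are open, `O ∩ L` and `O' ∩ L` are simply connected and `O ∩ O' ∩ L` is path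
connected (in particular nonempty), then `(O ∪ O') ∩ L` is simply connected.
[cite: HatcherAT2002, Lemma 1.15] -/
theorem isSimplyConnected_union_inter {Y : Type*} [TopologicalSpace Y] {L O O' : Set Y}
    (hO : IsOpen O) (hO' : IsOpen O') (h₁ : IsSimplyConnected (O ∩ L)) (h₂ : IsSimplyConnected (O' ∩ L))
    (h₁₂ : IsPathConnected (O ∩ O' ∩ L)) : IsSimplyConnected ((O ∪ O') ∩ L) := by
  set X : Set Y := (O ∪ O') ∩ L with hX
  have hU : IsOpen ((↑) ⁻¹' O : Set X) := hO.preimage continuous_subtype_val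
  have hV : IsOpen ((↑) ⁻¹' O' : Set X) := hO'.preimage continuous_subtype_val
  have hUeq : ((↑) ⁻¹' O : Set X) = (↑) ⁻¹' (O ∩ L) := by
    ext ⟨x, hx⟩; exact ⟨fun h => ⟨h, hx.2⟩, fun h => h.1⟩
  have hVeq : ((↑) ⁻¹' O' : Set X) = (↑) ⁻¹' (O' ∩ L) := by
    ext ⟨x, hx⟩; exact ⟨fun h => ⟨h, hx.2⟩, fun h => h.1⟩
  have hUsc : IsSimplyConnected ((↑) ⁻¹' O : Set X) := by
    rw [hUeq]
    exact Literature.AlgebraicTopology.FundamentalGroup.isSimplyConnected_preimage_val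
      (fun x hx => ⟨Or.inl hx.1, hx.2⟩) h₁
  have hVsc : IsSimplyConnected ((↑) ⁻¹' O' : Set X) := by
    rw [hVeq]
    exact Literature.AlgebraicTopology.FundamentalGroup.isSimplyConnected_preimage_val
      (fun x hx => ⟨Or.inr hx.1, hx.2⟩) h₂
  have hUV : ((↑) ⁻¹' O : Set X) ∪ (↑) ⁻¹' O' = univ := by
    ext ⟨x, hx⟩
    simp only [mem_union, mem_preimage, mem_univ, iff_true]
    exact hx.1
  have hmeet : IsPathConnected (((↑) ⁻¹' O : Set X) ∩ (↑) ⁻¹' O') := by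
    have : (((↑) ⁻¹' O : Set X) ∩ (↑) ⁻¹' O') = (↑) ⁻¹' (O ∩ O' ∩ L) := by
      ext ⟨x, hx⟩; exact ⟨fun h => ⟨⟨h.1, h.2⟩, hx.2⟩, fun h => ⟨h.1.1, h.1.2⟩⟩
    rw [this]
    exact h₁₂.preimage_coe (fun x hx => ⟨Or.inl hx.1.1, hx.2⟩)
  exact simplyConnectedSpace_of_isOpen_union hU hV hUV hUsc hVsc hmeet

end Generic

/-! ### §2 Great spheres -/

section GreatSphere

variable {E : Type*} [NormedAddCommGroup E] [InnerProductSpace ℝ E]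

/-- The **great sphere** orthogonal to `h`: `{u | ‖u‖ = 1, ⟪u, h⟫ = 0}`. [folklore] -/
def greatSphere (h : E) : Set E := {u | ‖u‖ = 1 ∧ ⟪u, h⟫ = 0}

/-- `mem_greatSphere` (mem greatSphere). [folklore] -/
theorem mem_greatSphere {h u : E} : u ∈ greatSphere h ↔ ‖u‖ = 1 ∧ ⟪u, h⟫ = 0 := Iff.rfl

/-- `isClosed_greatSphere` (isClosed greatSphere). [folklore] -/
theorem isClosed_greatSphere (h : E) : IsClosed (greatSphere h) :=
  (isClosed_eq continuous_norm continuous_const).inter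
    (isClosed_eq (continuous_id.inner continuous_const) continuous_const)

/-- **The great sphere orthogonal to `h` is the unit sphere of the hyperplane `(ℝ ∙ h)ᗮ`.**
[folklore] -/
def greatSphereHomeomorph (h : E) : greatSphere h ≃ₜ sphere (0 : (ℝ ∙ h)ᗮ) 1 where
  toFun u := ⟨⟨u.1, Submodule.mem_orthogonal_singleton_iff_inner_left.2 u.2.2⟩, by
    rw [mem_sphere_zero_iff_norm, Submodule.coe_norm]; exact u.2.1⟩
  invFun w := ⟨(w.1 : E), by
    have h1 : ‖(w.1 : E)‖ = 1 := by rw [← Submodule.coe_norm]; exact mem_sphere_zero_iff_norm.1 w.2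
    exact ⟨h1, Submodule.mem_orthogonal_singleton_iff_inner_left.1 w.1.2⟩⟩
  left_inv u := rfl
  right_inv w := rfl
  continuous_toFun := by
    refine Continuous.subtype_mk ?_ _
    exact continuous_subtype_val.subtype_mk _
  continuous_invFun := by
    refine Continuous.subtype_mk ?_ _
    exact Submodule.subtypeL _ |>.continuous.comp continuous_subtype_val

/-- **A great sphere of `Sⁿ` is simply connected for `n ≥ 3`** (it is an `Sⁿ⁻¹`). [folklore] -/
theorem simplyConnectedSpace_greatSphere {n : ℕ} [Fact (finrank ℝ E = n + 1)] (hn : 3 ≤ n) {h : E}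
    (hh : h ≠ 0) : SimplyConnectedSpace (greatSphere h) := by
  haveI : FiniteDimensional ℝ E := .of_fact_finrank_eq_succ n
  haveI : Fact (finrank ℝ (ℝ ∙ h)ᗮ = (n - 1) + 1) :=
    ⟨by rw [Submodule.finrank_orthogonal_span_singleton (n := n) hh]; omega⟩
  haveI := simplyConnectedSpace_sphere (E := (ℝ ∙ h)ᗮ) (n := n - 1) (by omega)
  exact (greatSphereHomeomorph h).toHomotopyEquiv.simplyConnectedSpace

/-- A great sphere of `Sⁿ` is path connected for `n ≥ 2`. [folklore] -/
theorem isPathConnected_greatSphere {n : ℕ} [Fact (finrank ℝ E = n + 1)] (hn : 2 ≤ n) {h : E}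
    (hh : h ≠ 0) : IsPathConnected (greatSphere h) := by
  haveI : FiniteDimensional ℝ E := .of_fact_finrank_eq_succ n
  have hrank : 1 < Module.rank ℝ (ℝ ∙ h)ᗮ := by
    rw [← Module.finrank_eq_rank, Submodule.finrank_orthogonal_span_singleton (n := n) hh]; exact_mod_cast hn
  have hs := isPathConnected_sphere hrank (0 : (ℝ ∙ h)ᗮ) zero_le_one
  haveI : PathConnectedSpace (sphere (0 : (ℝ ∙ h)ᗮ) 1) := isPathConnected_iff_pathConnectedSpace.1 hs
  haveI : PathConnectedSpace (greatSphere h) :=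
    (greatSphereHomeomorph h).symm.surjective.pathConnectedSpace (greatSphereHomeomorph h).symm.continuous
  exact isPathConnected_iff_pathConnectedSpace.2 this

/-- A great sphere of `Sⁿ` is nonempty for `n ≥ 1`. [folklore] -/
theorem greatSphere_nonempty {n : ℕ} [Fact (finrank ℝ E = n + 1)] (hn : 1 ≤ n) {h : E} (hh : h ≠ 0) :
    (greatSphere h).Nonempty := by
  haveI : FiniteDimensional ℝ E := .of_fact_finrank_eq_succ n
  have hpos : 0 < finrank ℝ (ℝ ∙ h)ᗮ := by rw [Submodule.finrank_orthogonal_span_singleton (n := n) hh]; omega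
  haveI : Nontrivial (ℝ ∙ h)ᗮ := Module.nontrivial_of_finrank_pos hpos
  obtain ⟨w, hw⟩ := exists_ne (0 : (ℝ ∙ h)ᗮ)
  refine ⟨(‖(w : E)‖)⁻¹ • (w : E), ?_, ?_⟩
  · have hw' : (w : E) ≠ 0 := by simpa using hw
    rw [norm_smul, norm_inv, norm_norm, inv_mul_cancel₀ (norm_ne_zero_iff.2 hw')]
  · rw [real_inner_smul_left, Submodule.mem_orthogonal_singleton_iff_inner_left.1 w.2, mul_zero]

end GreatSphere

/-! ### §3 Pushing a cap to a point -/

section CapPush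

variable {E : Type*} [NormedAddCommGroup E] [InnerProductSpace ℝ E]

open Plumbing

/-- The linear reparametrisation `[h', h) → [h', 1)` of the height. [folklore] -/
def capLin (h' h t : ℝ) : ℝ := h' + (t - h') * ((1 - h') / (h - h'))

/-- Its inverse `[h', 1) → [h', h)`. [folklore] -/
def capLinInv (h' h s : ℝ) : ℝ := h' + (s - h') * ((h - h') / (1 - h'))

section Lin

variable {h' h : ℝ} (hh : h' < h) (hh1 : h < 1)
include hh hh1

/-- `capLinInv_capLin` (capLinInv capLin). [folklore] -/
theorem capLinInv_capLin (t : ℝ) : capLinInv h' h (capLin h' h t) = t := by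
  have h1 : h - h' ≠ 0 := by linarith
  have h2 : 1 - h' ≠ 0 := by linarith
  rw [capLinInv, capLin, add_sub_cancel_left, mul_assoc, div_mul_div_comm, mul_comm (1 - h') (h - h'),
    div_self (mul_ne_zero h1 h2), mul_one]
  ring

/-- `capLin_capLinInv` (capLin capLinInv). [folklore] -/
theorem capLin_capLinInv (s : ℝ) : capLin h' h (capLinInv h' h s) = s := by
  have h1 : h - h' ≠ 0 := by linarith
  have h2 : 1 - h' ≠ 0 := by linarith
  rw [capLin, capLinInv, add_sub_cancel_left, mul_assoc, div_mul_div_comm, mul_comm (h - h') (1 - h'),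
    div_self (mul_ne_zero h2 h1), mul_one]
  ring

/-- `capLin_lt_one` (capLin lt one). [folklore] -/
theorem capLin_lt_one {t : ℝ} (ht : t < h) : capLin h' h t < 1 := by
  rw [capLin]
  have : (t - h') * ((1 - h') / (h - h')) < (h - h') * ((1 - h') / (h - h')) :=
    mul_lt_mul_of_pos_right (by linarith) (div_pos (by linarith) (by linarith))
  have heq : (h - h') * ((1 - h') / (h - h')) = 1 - h' := by
    rw [← mul_div_assoc, mul_div_cancel_left₀ _ (by linarith : h - h' ≠ 0)]
  rw [heq] at this
  linarith

/-- `lt_capLin` (lt capLin). [folklore] -/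
theorem lt_capLin {t : ℝ} (ht : h' < t) : h' < capLin h' h t := by
  rw [capLin]
  have : 0 < (t - h') * ((1 - h') / (h - h')) := mul_pos (by linarith) (div_pos (by linarith) (by linarith))
  linarith

omit hh hh1 in
/-- `capLin_self` (capLin self). [folklore] -/
theorem capLin_self : capLin h' h h' = h' := by rw [capLin]; ring

/-- `capLinInv_lt` (capLinInv lt). [folklore] -/
theorem capLinInv_lt {s : ℝ} (hs : s < 1) : capLinInv h' h s < h := by
  rw [capLinInv]
  have : (s - h') * ((h - h') / (1 - h')) < (1 - h') * ((h - h') / (1 - h')) :=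
    mul_lt_mul_of_pos_right (by linarith) (div_pos (by linarith) (by linarith))
  have heq : (1 - h') * ((h - h') / (1 - h')) = h - h' := by
    rw [← mul_div_assoc, mul_div_cancel_left₀ _ (by linarith : 1 - h' ≠ 0)]
  rw [heq] at this
  linarith

/-- `lt_capLinInv` (lt capLinInv). [folklore] -/
theorem lt_capLinInv {s : ℝ} (hs : h' < s) : h' < capLinInv h' h s := by
  rw [capLinInv]
  have : 0 < (s - h') * ((h - h') / (1 - h')) := mul_pos (by linarith) (div_pos (by linarith) (by linarith))
  linarith

omit hh hh1 in
/-- `capLinInv_self` (capLinInv self). [folklore] -/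
theorem capLinInv_self : capLinInv h' h h' = h' := by rw [capLinInv]; ring

omit hh hh1 in
/-- `continuous_capLin` (continuous capLin). [folklore] -/
@[fun_prop]
theorem continuous_capLin : Continuous (capLin h' h) := by unfold capLin; fun_prop

omit hh hh1 in
/-- `continuous_capLinInv` (continuous capLinInv). [folklore] -/
@[fun_prop]
theorem continuous_capLinInv : Continuous (capLinInv h' h) := by unfold capLinInv; fun_prop

end Lin

/-- **Changing the height of a unit vector along its meridian.** For unit vectors `e`, `p` with
`⟪p, e⟫ = t`, `t² < 1`, and a new height `L` with `L² < 1`, the vector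
`q = L e + (√(1 - L²)/√(1 - t²)) perp_e p` is a unit vector of height `L` on the meridian of `p`,
and the same recipe with `(t, L)` exchanged recovers `p` from `q`. [folklore] -/
theorem meridian_aux {e p : E} (he : ‖e‖ = 1) (hp : ‖p‖ = 1) {t L : ℝ} (hpt : ⟪p, e⟫ = t)
    (ht : t ^ 2 < 1) (hL : L ^ 2 < 1) :
    ‖L • e + (Real.sqrt (1 - L ^ 2) / Real.sqrt (1 - t ^ 2)) • perp e p‖ = 1 ∧
    ⟪L • e + (Real.sqrt (1 - L ^ 2) / Real.sqrt (1 - t ^ 2)) • perp e p, e⟫ = L ∧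
    perp e (L • e + (Real.sqrt (1 - L ^ 2) / Real.sqrt (1 - t ^ 2)) • perp e p) =
      (Real.sqrt (1 - L ^ 2) / Real.sqrt (1 - t ^ 2)) • perp e p ∧
    t • e + (Real.sqrt (1 - t ^ 2) / Real.sqrt (1 - L ^ 2)) •
      perp e (L • e + (Real.sqrt (1 - L ^ 2) / Real.sqrt (1 - t ^ 2)) • perp e p) = p := by
  set β := Real.sqrt (1 - L ^ 2) / Real.sqrt (1 - t ^ 2) with hβ
  have hst : 0 < Real.sqrt (1 - t ^ 2) := Real.sqrt_pos.2 (by linarith)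
  have hsL : 0 < Real.sqrt (1 - L ^ 2) := Real.sqrt_pos.2 (by linarith)
  have hperp0 : ⟪perp e p, e⟫ = 0 := inner_perp_left he p
  have hperp : perp e (L • e + β • perp e p) = β • perp e p := by
    rw [add_comm]
    exact perp_add_smul_of_inner_eq_zero he (by rw [real_inner_smul_left, hperp0, mul_zero]) L
  have hee : ⟪e, e⟫ = 1 := by rw [real_inner_self_eq_norm_sq, he, one_pow]
  have hinner : ⟪L • e + β • perp e p, e⟫ = L := by
    rw [inner_add_left, real_inner_smul_left, real_inner_smul_left, hee, hperp0]; ring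
  have hnp : ‖perp e p‖ ^ 2 = 1 - t ^ 2 := by rw [norm_perp_sq he, hp, hpt]; ring
  refine ⟨?_, hinner, hperp, ?_⟩
  · have hβsq : β ^ 2 * (1 - t ^ 2) = 1 - L ^ 2 := by
      rw [hβ, div_pow, Real.sq_sqrt (by linarith), Real.sq_sqrt (by linarith),
        div_mul_eq_mul_div, mul_div_cancel_right₀ _ (by linarith : 1 - t ^ 2 ≠ 0)]
    have h2 : ‖L • e + β • perp e p‖ ^ 2 = 1 := by
      rw [← real_inner_self_eq_norm_sq]
      have hpe : ⟪e, perp e p⟫ = 0 := by rw [real_inner_comm]; exact hperp0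
      simp only [inner_add_left, inner_add_right, real_inner_smul_left, real_inner_smul_right, hee,
        hperp0, hpe, mul_zero, add_zero, zero_add, mul_one]
      rw [real_inner_self_eq_norm_sq, hnp]
      linear_combination hβsq
    have h0 : 0 ≤ ‖L • e + β • perp e p‖ := norm_nonneg _
    nlinarith [h2, h0]
  · rw [hperp, smul_smul]
    have : Real.sqrt (1 - t ^ 2) / Real.sqrt (1 - L ^ 2) * β = 1 := by
      rw [hβ]; field_simp
    rw [this, one_smul, ← hpt, add_comm]
    exact perp_add_smul e p

variable (e : E) (h' h : ℝ)

/-- **The cap push**: the identity below height `h'`, and on `h' < ⟪p, e⟫ < h` the meridional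
push to heights `h' < · < 1` (so that the annulus below the cap `{⟪p, e⟫ ≥ h}` fills the punctured
cap). [folklore] -/
def capPush (p : E) : E :=
  if ⟪p, e⟫ ≤ h' then p else
    capLin h' h ⟪p, e⟫ • e +
      (Real.sqrt (1 - capLin h' h ⟪p, e⟫ ^ 2) / Real.sqrt (1 - ⟪p, e⟫ ^ 2)) • perp e p

/-- **The cap pull**, inverse to `capPush`. [folklore] -/
def capPull (q : E) : E :=
  if ⟪q, e⟫ ≤ h' then q else
    capLinInv h' h ⟪q, e⟫ • e +
      (Real.sqrt (1 - capLinInv h' h ⟪q, e⟫ ^ 2) / Real.sqrt (1 - ⟪q, e⟫ ^ 2)) • perp e q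

variable {e h' h} (he : ‖e‖ = 1) (hh' : -1 < h') (hh : h' < h) (hh1 : h < 1)
include he hh' hh hh1

/-- Properties of the cap push on the annulus `h' < ⟪p, e⟫ < h`. [folklore] -/
theorem capPush_spec {p : E} (hp : ‖p‖ = 1) (h1 : h' < ⟪p, e⟫) (h2 : ⟪p, e⟫ < h) :
    ‖capPush e h' h p‖ = 1 ∧ ⟪capPush e h' h p, e⟫ = capLin h' h ⟪p, e⟫ ∧
      capPull e h' h (capPush e h' h p) = p := by
  have hL1 := capLin_lt_one hh hh1 h2
  have hL2 := lt_capLin hh hh1 h1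
  have ht : ⟪p, e⟫ ^ 2 < 1 := by nlinarith
  have hL : capLin h' h ⟪p, e⟫ ^ 2 < 1 := by nlinarith
  obtain ⟨hn, hi, _, hback⟩ := meridian_aux he hp rfl ht hL
  have hdef : capPush e h' h p = capLin h' h ⟪p, e⟫ • e +
      (Real.sqrt (1 - capLin h' h ⟪p, e⟫ ^ 2) / Real.sqrt (1 - ⟪p, e⟫ ^ 2)) • perp e p := by
    rw [capPush, if_neg (not_le.2 h1)]
  rw [hdef]
  refine ⟨hn, hi, ?_⟩
  rw [capPull, if_neg (by rw [hi]; exact not_le.2 hL2), hi, capLinInv_capLin hh hh1]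
  exact hback

/-- Properties of the cap pull on the punctured cap `h' < ⟪q, e⟫ < 1`. [folklore] -/
theorem capPull_spec {q : E} (hq : ‖q‖ = 1) (h1 : h' < ⟪q, e⟫) (h2 : ⟪q, e⟫ < 1) :
    ‖capPull e h' h q‖ = 1 ∧ ⟪capPull e h' h q, e⟫ = capLinInv h' h ⟪q, e⟫ ∧
      capPush e h' h (capPull e h' h q) = q := by
  have hL1 := capLinInv_lt hh hh1 h2
  have hL2 := lt_capLinInv hh hh1 h1
  have hge : -1 ≤ ⟪q, e⟫ := by
    have := abs_real_inner_le_norm q e; rw [hq, he, one_mul] at this; exact (abs_le.1 this).1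
  have ht : ⟪q, e⟫ ^ 2 < 1 := by nlinarith
  have hL : capLinInv h' h ⟪q, e⟫ ^ 2 < 1 := by nlinarith
  obtain ⟨hn, hi, _, hback⟩ := meridian_aux he hq rfl ht hL
  have hdef : capPull e h' h q = capLinInv h' h ⟪q, e⟫ • e +
      (Real.sqrt (1 - capLinInv h' h ⟪q, e⟫ ^ 2) / Real.sqrt (1 - ⟪q, e⟫ ^ 2)) • perp e q := by
    rw [capPull, if_neg (not_le.2 h1)]
  rw [hdef]
  refine ⟨hn, hi, ?_⟩
  rw [capPush, if_neg (by rw [hi]; exact not_le.2 hL2), hi, capLin_capLinInv hh hh1]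
  exact hback

omit he hh' hh hh1 in
/-- `capPush_of_le` (capPush of le). [folklore] -/
theorem capPush_of_le {p : E} (hp : ⟪p, e⟫ ≤ h') : capPush e h' h p = p := by rw [capPush, if_pos hp]

omit he hh' hh hh1 in
/-- `capPull_of_le` (capPull of le). [folklore] -/
theorem capPull_of_le {q : E} (hq : ⟪q, e⟫ ≤ h') : capPull e h' h q = q := by rw [capPull, if_pos hq]

omit he in
/-- **Continuity of the cap push** on `{⟪p, e⟫ < h}`. [folklore] -/
theorem continuousOn_capPush : ContinuousOn (capPush e h' h) {p : E | ⟪p, e⟫ < h} := by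
  have ht : Continuous fun p : E => ⟪p, e⟫ := continuous_id.inner continuous_const
  refine ContinuousOn.if ?_ continuousOn_id ?_
  · rintro p ⟨_, hp⟩
    have hp' : ⟪p, e⟫ = h' := frontier_le_subset_eq ht continuous_const hp
    rw [hp', capLin_self, div_self (Real.sqrt_pos.2 (by nlinarith)).ne', one_smul]
    rw [← hp', add_comm, perp_add_smul]
  · have hcl : closure {p : E | ¬⟪p, e⟫ ≤ h'} ⊆ {p | h' ≤ ⟪p, e⟫} := by
      have : {p : E | ¬⟪p, e⟫ ≤ h'} = {p | h' < ⟪p, e⟫} := by ext; simp [not_le]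
      rw [this]; exact closure_lt_subset_le continuous_const ht
    intro p hp
    have h1 : h' ≤ ⟪p, e⟫ := hcl hp.2
    have h2 : ⟪p, e⟫ < h := hp.1
    have hpos : 0 < 1 - ⟪p, e⟫ ^ 2 := by nlinarith
    refine ContinuousAt.continuousWithinAt ?_
    have hsq : ContinuousAt (fun p : E => Real.sqrt (1 - ⟪p, e⟫ ^ 2)) p := by fun_prop
    refine ((continuous_capLin.continuousAt.comp ht.continuousAt).smul continuousAt_const).add
      (ContinuousAt.smul (ContinuousAt.div ?_ hsq (Real.sqrt_pos.2 hpos).ne') (continuous_perp e).continuousAt)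
    fun_prop

omit he in
/-- **Continuity of the cap pull** on `{⟪q, e⟫ < 1}`. [folklore] -/
theorem continuousOn_capPull : ContinuousOn (capPull e h' h) {q : E | ⟪q, e⟫ < 1} := by
  have ht : Continuous fun p : E => ⟪p, e⟫ := continuous_id.inner continuous_const
  refine ContinuousOn.if ?_ continuousOn_id ?_
  · rintro p ⟨_, hp⟩
    have hp' : ⟪p, e⟫ = h' := frontier_le_subset_eq ht continuous_const hp
    rw [hp', capLinInv_self, div_self (Real.sqrt_pos.2 (by nlinarith)).ne', one_smul]
    rw [← hp', add_comm, perp_add_smul]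
  · have hcl : closure {p : E | ¬⟪p, e⟫ ≤ h'} ⊆ {p | h' ≤ ⟪p, e⟫} := by
      have : {p : E | ¬⟪p, e⟫ ≤ h'} = {p | h' < ⟪p, e⟫} := by ext; simp [not_le]
      rw [this]; exact closure_lt_subset_le continuous_const ht
    intro p hp
    have h1 : h' ≤ ⟪p, e⟫ := hcl hp.2
    have h2 : ⟪p, e⟫ < 1 := hp.1
    have hpos : 0 < 1 - ⟪p, e⟫ ^ 2 := by nlinarith
    refine ContinuousAt.continuousWithinAt ?_
    have hsq : ContinuousAt (fun p : E => Real.sqrt (1 - ⟪p, e⟫ ^ 2)) p := by fun_prop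
    refine ((continuous_capLinInv.continuousAt.comp ht.continuousAt).smul continuousAt_const).add
      (ContinuousAt.smul (ContinuousAt.div ?_ hsq (Real.sqrt_pos.2 hpos).ne') (continuous_perp e).continuousAt)
    fun_prop

end CapPush

/-! ### §4 Removing a cap from an open simply connected subset of the sphere -/

section Sphere

variable {E : Type*} [NormedAddCommGroup E] [InnerProductSpace ℝ E]

/-- A unit vector of height `1` relative to the unit vector `e` is `e`. [folklore] -/
theorem eq_of_inner_eq_one {e q : sphere (0 : E) 1} (h : ⟪(q : E), (e : E)⟫ = 1) : q = e :=
  Subtype.ext ((inner_eq_one_iff_of_norm_eq_one (𝕜 := ℝ) (norm_eq_of_mem_sphere q)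
    (norm_eq_of_mem_sphere e)).1 h)

/-- Heights of unit vectors are `≤ 1`, with equality only at `e`. [folklore] -/
theorem inner_lt_one_of_ne {e q : sphere (0 : E) 1} (h : q ≠ e) : ⟪(q : E), (e : E)⟫ < 1 := by
  have hle : ⟪(q : E), (e : E)⟫ ≤ 1 := by
    have := real_inner_le_norm (q : E) (e : E)
    rwa [norm_eq_of_mem_sphere q, norm_eq_of_mem_sphere e, one_mul] at this
  exact lt_of_le_of_ne hle fun h1 => h (eq_of_inner_eq_one h1)

variable (e : sphere (0 : E) 1) {h' h : ℝ} (hh' : -1 < h') (hh : h' < h) (hh1 : h < 1)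
  {W : Set (sphere (0 : E) 1)} (hsub : {q : sphere (0 : E) 1 | h' < ⟪(q : E), (e : E)⟫} ⊆ W)
include hh' hh hh1 hsub

/-- **The cap homeomorphism**: `W` minus the closed cap `{⟪q, e⟫ ≥ h}` is homeomorphic to
`W ∖ {e}`, for any `W` containing the open cap `{⟪q, e⟫ > h'}`, `h' < h` (push the annulus
`h' < ⟪q, e⟫ < h` along meridians onto the punctured cap). [folklore] -/
def capHomeomorph :
    ↥(W \ {q : sphere (0 : E) 1 | h ≤ ⟪(q : E), (e : E)⟫}) ≃ₜ ↥(W \ {e}) where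
  toFun x := by
    have he : ‖(e : E)‖ = 1 := norm_eq_of_mem_sphere e
    have hx1 : ‖(x.1 : E)‖ = 1 := norm_eq_of_mem_sphere x.1
    have hx2 : ⟪(x.1 : E), (e : E)⟫ < h := by have hx := x.2.2; simp only [mem_setOf_eq, not_le] at hx; exact hx
    refine ⟨⟨capPush (e : E) h' h x.1, ?_⟩, ?_, ?_⟩
    · rw [mem_sphere_zero_iff_norm]
      by_cases hle : ⟪(x.1 : E), (e : E)⟫ ≤ h'
      · rw [capPush_of_le hle]; exact hx1
      · exact (capPush_spec he hh' hh hh1 hx1 (not_le.1 hle) hx2).1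
    · by_cases hle : ⟪(x.1 : E), (e : E)⟫ ≤ h'
      · simp only [capPush_of_le hle, Subtype.coe_eta]; exact x.2.1
      · apply hsub
        change h' < ⟪capPush (e : E) h' h x.1, (e : E)⟫
        rw [(capPush_spec he hh' hh hh1 hx1 (not_le.1 hle) hx2).2.1]
        exact lt_capLin hh hh1 (not_le.1 hle)
    · intro heq
      rw [mem_singleton_iff] at heq
      have h1 : ⟪capPush (e : E) h' h x.1, (e : E)⟫ = 1 := by
        have := congrArg (fun q : sphere (0 : E) 1 => ⟪(q : E), (e : E)⟫) heq
        simp only at this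
        rw [this, real_inner_self_eq_norm_sq, he, one_pow]
      by_cases hle : ⟪(x.1 : E), (e : E)⟫ ≤ h'
      · rw [capPush_of_le hle] at h1; linarith
      · rw [(capPush_spec he hh' hh hh1 hx1 (not_le.1 hle) hx2).2.1] at h1
        linarith [capLin_lt_one hh hh1 hx2]
  invFun y := by
    have he : ‖(e : E)‖ = 1 := norm_eq_of_mem_sphere e
    have hy1 : ‖(y.1 : E)‖ = 1 := norm_eq_of_mem_sphere y.1
    have hy2 : ⟪(y.1 : E), (e : E)⟫ < 1 := inner_lt_one_of_ne (by simpa using y.2.2)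
    refine ⟨⟨capPull (e : E) h' h y.1, ?_⟩, ?_, ?_⟩
    · rw [mem_sphere_zero_iff_norm]
      by_cases hle : ⟪(y.1 : E), (e : E)⟫ ≤ h'
      · rw [capPull_of_le hle]; exact hy1
      · exact (capPull_spec he hh' hh hh1 hy1 (not_le.1 hle) hy2).1
    · by_cases hle : ⟪(y.1 : E), (e : E)⟫ ≤ h'
      · simp only [capPull_of_le hle, Subtype.coe_eta]; exact y.2.1
      · apply hsub
        change h' < ⟪capPull (e : E) h' h y.1, (e : E)⟫
        rw [(capPull_spec he hh' hh hh1 hy1 (not_le.1 hle) hy2).2.1]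
        exact lt_capLinInv hh hh1 (not_le.1 hle)
    · change ¬ h ≤ ⟪capPull (e : E) h' h y.1, (e : E)⟫
      rw [not_le]
      by_cases hle : ⟪(y.1 : E), (e : E)⟫ ≤ h'
      · rw [capPull_of_le hle]; linarith
      · rw [(capPull_spec he hh' hh hh1 hy1 (not_le.1 hle) hy2).2.1]
        exact capLinInv_lt hh hh1 hy2
  left_inv x := by
    have he : ‖(e : E)‖ = 1 := norm_eq_of_mem_sphere e
    have hx1 : ‖(x.1 : E)‖ = 1 := norm_eq_of_mem_sphere x.1
    have hx2 : ⟪(x.1 : E), (e : E)⟫ < h := by have hx := x.2.2; simp only [mem_setOf_eq, not_le] at hx; exact hx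
    ext1; ext1
    change capPull (e : E) h' h (capPush (e : E) h' h x.1) = x.1
    by_cases hle : ⟪(x.1 : E), (e : E)⟫ ≤ h'
    · rw [capPush_of_le hle, capPull_of_le hle]
    · exact (capPush_spec he hh' hh hh1 hx1 (not_le.1 hle) hx2).2.2
  right_inv y := by
    have he : ‖(e : E)‖ = 1 := norm_eq_of_mem_sphere e
    have hy1 : ‖(y.1 : E)‖ = 1 := norm_eq_of_mem_sphere y.1
    have hy2 : ⟪(y.1 : E), (e : E)⟫ < 1 := inner_lt_one_of_ne (by simpa using y.2.2)
    ext1; ext1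
    change capPush (e : E) h' h (capPull (e : E) h' h y.1) = y.1
    by_cases hle : ⟪(y.1 : E), (e : E)⟫ ≤ h'
    · rw [capPull_of_le hle, capPush_of_le hle]
    · exact (capPull_spec he hh' hh hh1 hy1 (not_le.1 hle) hy2).2.2
  continuous_toFun := by
    refine Continuous.subtype_mk (Continuous.subtype_mk ?_ _) _
    have hc := continuousOn_capPush (e := (e : E)) hh' hh hh1
    refine (hc.comp_continuous (continuous_subtype_val.comp continuous_subtype_val) ?_)
    intro x
    have hx := x.2.2
    simp only [mem_setOf_eq, not_le] at hx
    exact hx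
  continuous_invFun := by
    refine Continuous.subtype_mk (Continuous.subtype_mk ?_ _) _
    have hc := continuousOn_capPull (e := (e : E)) hh' hh hh1
    refine (hc.comp_continuous (continuous_subtype_val.comp continuous_subtype_val) ?_)
    intro y; exact inner_lt_one_of_ne (by simpa using y.2.2)

omit hh' hh hh1 hsub in
/-- **Removing a point from an open simply connected subset of `Sⁿ`, `n ≥ 3`, keeps it simply
connected** (general position; the stereographic chart at the point is a Euclidean neighbourhood
of dimension `n ≥ 3`). [folklore] -/
theorem isSimplyConnected_diff_singleton {n : ℕ} [Fact (finrank ℝ E = n + 1)] (hn : 3 ≤ n)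
    (hWo : IsOpen W) (hW : IsSimplyConnected W) (heW : e ∈ W) : IsSimplyConnected (W \ {e}) := by
  haveI : SimplyConnectedSpace W := hW
  -- the stereographic chart from `-e`, inverted: an open embedding `ℝⁿ → Sⁿ` with `0 ↦ e`
  set st := stereographic' n (-e) with hst
  have hsymm_src : st.symm.source = univ := by rw [OpenPartialHomeomorph.symm_source, hst, stereographic'_target]
  have hg : IsOpenEmbedding st.symm := st.symm.to_isOpenEmbedding hsymm_src
  have he_src : e ∈ st.source := by
    rw [hst, stereographic'_source, mem_compl_singleton_iff]
    intro h
    have := congrArg (fun q : sphere (0 : E) 1 => (q : E)) h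
    simp only [coe_neg_sphere] at this
    have h0 : (e : E) = 0 := by
      have h2 : (2 : ℝ) • (e : E) = 0 := by rw [two_smul]; nth_rewrite 2 [this]; exact add_neg_cancel _
      exact (smul_eq_zero.1 h2).resolve_left two_ne_zero
    exact ne_zero_of_mem_unit_sphere e h0
  have hg0 : st.symm 0 = e := by
    have h1 : st e = 0 := by
      have := stereographic'_apply_neg (n := n) (-e)
      rw [neg_neg] at this; rw [hst]; exact this
    rw [← h1]; exact st.left_inv he_src
  -- shrink to a ball mapping into `W`
  have hpre : IsOpen (st.symm ⁻¹' W) := hg.continuous.isOpen_preimage W hWo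
  have h0mem : (0 : EuclideanSpace ℝ (Fin n)) ∈ st.symm ⁻¹' W := by rw [mem_preimage, hg0]; exact heW
  obtain ⟨r, hr, hrW⟩ := Metric.isOpen_iff.1 hpre 0 h0mem
  let ub := OpenPartialHomeomorph.univBall (0 : EuclideanSpace ℝ (Fin n)) r
  have hub : IsOpenEmbedding ub := ub.to_isOpenEmbedding (OpenPartialHomeomorph.univBall_source 0 r)
  have hub_mem : ∀ v, ub v ∈ ball (0 : EuclideanSpace ℝ (Fin n)) r := fun v => by
    rw [← OpenPartialHomeomorph.univBall_target 0 hr]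
    exact ub.map_source (by rw [OpenPartialHomeomorph.univBall_source]; exact mem_univ v)
  have hcomp : IsOpenEmbedding (st.symm ∘ ub) := hg.comp hub
  have hmemW : ∀ v, (st.symm ∘ ub) v ∈ W := fun v => hrW (hub_mem v)
  let i : EuclideanSpace ℝ (Fin n) → W := W.codRestrict (st.symm ∘ ub) hmemW
  have hi : IsOpenEmbedding i :=
    Literature.AlgebraicTopology.FundamentalGroupoid.isOpenEmbedding_codRestrict hcomp hmemW
  have hi0 : (i 0 : sphere (0 : E) 1) = e := by
    change st.symm (ub 0) = e
    rw [OpenPartialHomeomorph.univBall_apply_zero]; exact hg0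
  have h3 : 2 < finrank ℝ (EuclideanSpace ℝ (Fin n)) := by rw [finrank_euclideanSpace_fin]; omega
  have h := Literature.AlgebraicTopology.FundamentalGroupoid.isSimplyConnected_compl_singleton_of_isOpenEmbedding hi h3
  rw [← IsEmbedding.subtypeVal.isSimplyConnected_image] at h
  convert h using 1
  ext x
  simp only [mem_sdiff, mem_singleton_iff, mem_image, mem_compl_iff, Subtype.exists, exists_and_right,
    exists_eq_right]
  constructor
  · rintro ⟨hx, hxe⟩
    exact ⟨hx, fun h' => hxe (by rw [← hi0, ← h'])⟩
  · rintro ⟨hx, h'⟩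
    exact ⟨hx, fun hxe => h' (Subtype.ext (hxe.trans hi0.symm))⟩

omit hsub in
/-- **Removing a round cap.** If `W ⊆ Sⁿ` (`n ≥ 3`) is open and simply connected and contains the
open cap `{⟪q, e⟫ > h'}`, then `W` minus the closed cap `{⟪q, e⟫ ≥ h}` (`h' < h < 1`) is simply
connected. [folklore] -/
theorem isSimplyConnected_diff_cap {n : ℕ} [Fact (finrank ℝ E = n + 1)] (hn : 3 ≤ n)
    (hWo : IsOpen W) (hW : IsSimplyConnected W)
    (hsub : {q : sphere (0 : E) 1 | h' < ⟪(q : E), (e : E)⟫} ⊆ W) :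
    IsSimplyConnected (W \ {q : sphere (0 : E) 1 | h ≤ ⟪(q : E), (e : E)⟫}) := by
  have heW : e ∈ W := hsub (by
    change h' < ⟪(e : E), (e : E)⟫
    rw [real_inner_self_eq_norm_sq, norm_eq_of_mem_sphere, one_pow]; linarith)
  have h1 := isSimplyConnected_diff_singleton e hn hWo hW heW
  exact (isSimplyConnected_iff_of_homeomorph (capHomeomorph e hh' hh hh1 hsub)).2 h1

end Sphere

/-! ### §5 The sphere minus finitely many separated caps -/

section Caps

variable {E : Type*} [NormedAddCommGroup E] [InnerProductSpace ℝ E]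

/-- **`Sⁿ` minus finitely many pairwise separated closed round caps is simply connected**
(`n ≥ 3`): the caps `{⟪q, uᵢ⟫ ≥ h}`, `i ∈ T`, are *separated at height `h'`* if the open cap
`{⟪q, uᵢ⟫ > h'}` misses the closed cap of every other `uⱼ`. Induction on `T`, removing one cap at a
time (`isSimplyConnected_diff_cap`). [folklore] -/
theorem isSimplyConnected_forall_inner_lt {n : ℕ} [Fact (finrank ℝ E = n + 1)] (hn : 3 ≤ n)
    {ι : Type*} (T : Finset ι) (u : ι → sphere (0 : E) 1) {h' h : ℝ} (hh' : -1 < h') (hh : h' < h)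
    (hh1 : h < 1)
    (hsep : ∀ i ∈ T, ∀ j ∈ T, i ≠ j → ∀ q : sphere (0 : E) 1,
      h' < ⟪(q : E), (u i : E)⟫ → ⟪(q : E), (u j : E)⟫ < h) :
    IsSimplyConnected {q : sphere (0 : E) 1 | ∀ i ∈ T, ⟪(q : E), (u i : E)⟫ < h} := by
  classical
  induction T using Finset.induction_on with
  | empty =>
    simp only [Finset.notMem_empty, IsEmpty.forall_iff, implies_true, setOf_true]
    haveI := simplyConnectedSpace_sphere (E := E) (n := n) (by omega)
    exact (isSimplyConnected_iff_of_homeomorph (Homeomorph.Set.univ (sphere (0 : E) 1))).2 ‹_›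
  | insert i T hiT ih =>
    set W : Set (sphere (0 : E) 1) := {q | ∀ j ∈ T, ⟪(q : E), (u j : E)⟫ < h} with hW
    have hsep' : ∀ i' ∈ T, ∀ j ∈ T, i' ≠ j → ∀ q : sphere (0 : E) 1,
        h' < ⟪(q : E), (u i' : E)⟫ → ⟪(q : E), (u j : E)⟫ < h := fun i' hi' j hj =>
      hsep i' (Finset.mem_insert_of_mem hi') j (Finset.mem_insert_of_mem hj)
    have hWsc : IsSimplyConnected W := ih hsep'
    have hWo : IsOpen W := by
      have : W = ⋂ j ∈ T, {q : sphere (0 : E) 1 | ⟪(q : E), (u j : E)⟫ < h} := by ext q; simp [hW]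
      rw [this]
      exact isOpen_biInter_finset fun j _ =>
        isOpen_lt (continuous_subtype_val.inner continuous_const) continuous_const
    have hsubW : {q : sphere (0 : E) 1 | h' < ⟪(q : E), (u i : E)⟫} ⊆ W := by
      intro q hq j hj
      exact hsep i (Finset.mem_insert_self i T) j (Finset.mem_insert_of_mem hj)
        (fun hij => hiT (hij ▸ hj)) q hq
    have key := isSimplyConnected_diff_cap (u i) hh' hh hh1 hn hWo hWsc hsubW
    convert key using 1
    ext q
    simp only [Finset.mem_insert, forall_eq_or_imp, mem_setOf_eq, mem_sdiff, not_le, hW]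
    tauto

end Caps

end SphereCaps

end Literature.Topology.FourManifolds
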